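import Summits.BirchSwinnertonDyer.BirchSwinnertonDyer.Theorems.AdditiveKolyvaginRoadManinFrameResidueProperRUnitTwist
import Summits.BirchSwinnertonDyer.BirchSwinnertonDyer.Theorems.AdditiveKolyvaginRoadManinFrameResidueProperRTameTwistArith
import HarnessLib

/-!
# Route `AdditiveKolyvaginRoad`, crux `ManinFrameResidueProperR` (stmt-BirchSwinnertonDyer-20709), line
# `birth`, stub TDS (`p ≥ 11`): the TAME-TWIST lever, part 1 — the all-characters Kato–Kosters–Pannekoek
# reading (cited named fact) and ONE odd character: `Σ_a χ(a){∞,a/d′}_f ∈ 𝓞_(p)·|Ω⁻(W)|·i` — `--supports`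

Cell `pub/bsd-wall` (D-0120, W-ALL row 2), seat `bsd-wall-manin-p1` g3. THEOREMS ONLY; the published input is
the Literature fact `Literature.NumberTheory.EllipticCurves.kato_neron_isIntegral_twistedSymbolSum_of_additive`
(the all-characters form of the sibling `kato_neron_padicValRat_twistedSymbolSum_nonneg_of_additive`, same
derivation — Kato (8.1.3)/9.7/6.6 + Kim–Nakamura 2.1/2.4 ⟸ Kosters–Pannekoek Thm. 1, read in Néron units at
an additive `p > 7` with `E[p]` irreducible; NO Manin binder), cited, never asserted. No `sorry`; nothing is
closed. The assembly (every `γ ∈ Γ₀(N)`, Manin's `p`-part at a lattice-optimal datum, the frame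
corollaries) is in the sequels `…RTameTwistSymbols.lean` / `…RTameTwist.lean`, whose module docstrings
carry the full argument.

* §0 the fact (hypothesis `hK`).
* §1 products of `p`-unit Euler factors; the SYMMETRIC factor `(ℓ − aζ)(ℓ − aζ⁻¹)` is a `p`-unit when
  `ζⁿ = 1`, `n` avoids the odd primes of `p − 1`, and no `2`-power of `ℓ/a (mod p)` is `1` (hypothesis
  (A²) of the lever), by `…RTameTwistArith` §2.
* §2 `pint_twistedSymbolSum_div`: for a prime `d′ > N` with `p ∤ d′ − 1`, `r ∤ d′ − 1` (odd `r ∣ p − 1`)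
  and an ODD character `χ (mod d′)`: `Σ_a χ(a){∞, a/d′}_f / (|Ω⁻(W)| i)` is `p`-integral, GRANTED §0.
-/

set_option autoImplicit false
set_option linter.dupNamespace false

noncomputable section

open scoped Classical MatrixGroups

open WeierstrassCurve NumberField Literature.NumberTheory.EllipticCurves
  Literature.NumberTheory.EllipticCurves.ModularForms
  Literature.NumberTheory.EllipticCurves.Rank1Residual
  Literature.NumberTheory.DiophantineGeometry IsDedekindDomain Rat.HeightOneSpectrum
  Summit.BirchSwinnertonDyer.Rank1Residual Summit.BirchSwinnertonDyer.Rank1Residual.Additive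
  CongruenceSubgroup Complex

namespace Summit.BirchSwinnertonDyer.BirchSwinnertonDyer.Theorems.ManinFrameResidueProperRTameTwist


/-! ### §0 The published input is the Literature fact
`Literature.NumberTheory.EllipticCurves.kato_neron_isIntegral_twistedSymbolSum_of_additive`
(`KatoAdditiveTwistedValueNeronIntegrality.lean`, the all-characters sibling of
`kato_neron_padicValRat_twistedSymbolSum_nonneg_of_additive`: Kato (8.1.3)/9.7/6.6 + Kim–Nakamura 2.1/2.4 ⟸
Kosters–Pannekoek Thm. 1 read in Néron units at an additive `p > 7`, `E[p]` irreducible, any primitive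
`χ ≠ 1` with `p ∤ ord χ`, symmetric Euler factor; no Manin binder), taken as the hypothesis `hK` below. -/

/-! ### §1 Products of `p`-unit Euler factors (plumbing over `…RTameTwistArith` §2) -/

section Products

variable {p : ℕ}

/-- A finite product of `p`-unit factors (`e_i w_i = t_i`, `w_i` integral, `p ∤ t_i ∈ ℤ`) is a `p`-unit
factor. [folklore] -/
theorem exists_prod_mul_eq (hp : p.Prime) {ι : Type*} (s : Finset ι) (e : ι → ℂ)
    (h : ∀ i ∈ s, ∃ (w : ℂ) (t : ℤ), IsIntegral ℤ w ∧ e i * w = t ∧ ¬ (p : ℤ) ∣ t) :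
    ∃ (w : ℂ) (t : ℤ), IsIntegral ℤ w ∧ (∏ i ∈ s, e i) * w = t ∧ ¬ (p : ℤ) ∣ t := by
  induction s using Finset.induction_on with
  | empty => exact ⟨1, 1, isIntegral_one, by simp, fun h ↦ hp.one_lt.ne' (by
      have := Int.eq_one_of_dvd_one (Int.natCast_nonneg p) h; exact_mod_cast this)⟩
  | insert a s ha ih =>
    obtain ⟨w, t, hw, hwt, ht⟩ := h a (Finset.mem_insert_self a s)
    obtain ⟨w', t', hw', hwt', ht'⟩ := ih fun i hi ↦ h i (Finset.mem_insert_of_mem hi)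
    refine ⟨w * w', t * t', hw.mul hw', ?_, fun hdvd ↦ ((Int.prime_iff_natAbs_prime.mpr
      (by simpa using hp)).dvd_or_dvd hdvd).elim ht ht'⟩
    rw [Finset.prod_insert ha, show e a * (∏ i ∈ s, e i) * (w * w') = (e a * w) * ((∏ i ∈ s, e i) * w')
      by ring, hwt, hwt']
    push_cast; ring

/-- **The symmetric Euler factor at `ℓ ∥ N` is a `p`-unit** under (A²): for `ζ` with `ζⁿ = 1`
(`n > 0` avoiding the odd primes of `p − 1`), `ℓ ≢ 0 (mod p)`, and no `2`-power of `ℓ/a (mod p)` equal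
to `1`, the factor `(ℓ − aζ)(ℓ − aζ⁻¹)` times an algebraic integer is an integer prime to `p`. [folklore] -/
theorem exists_symmEulerFactor_mul_eq [hp : Fact p.Prime] (ℓ : ℕ) (a : ℤ)
    (hℓ : ((ℓ : ZMod p)) ≠ 0) (hA : ∀ j : ℕ, ((ℓ : ZMod p) / (a : ZMod p)) ^ 2 ^ j ≠ 1)
    {n : ℕ} (hn : 0 < n) (hr : ∀ r : ℕ, r.Prime → r ≠ 2 → r ∣ p - 1 → ¬ r ∣ n)
    {ζ : ℂ} (hζ : ζ ^ n = 1) :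
    ∃ (w : ℂ) (t : ℤ), IsIntegral ℤ w ∧
      (((ℓ : ℂ) - (a : ℂ) * ζ) * ((ℓ : ℂ) - (a : ℂ) * ζ⁻¹)) * w = t ∧ ¬ (p : ℤ) ∣ t := by
  have hℓ' : (((ℓ : ℤ) : ZMod p)) ≠ 0 := by simpa using hℓ
  have hA' : ∀ j : ℕ, (((ℓ : ℤ) : ZMod p) / (a : ZMod p)) ^ 2 ^ j ≠ 1 := by simpa using hA
  have hζ' : ζ⁻¹ ^ n = 1 := by rw [inv_pow, hζ, inv_one]
  obtain ⟨w₁, t₁, hw₁, he₁, ht₁⟩ := exists_eulerFactor_mul_eq_of_not_twoPow hℓ' hA' hn hr hζ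
  obtain ⟨w₂, t₂, hw₂, he₂, ht₂⟩ := exists_eulerFactor_mul_eq_of_not_twoPow hℓ' hA' hn hr hζ'
  refine ⟨w₁ * w₂, t₁ * t₂, hw₁.mul hw₂, ?_, fun hdvd ↦ ((Int.prime_iff_natAbs_prime.mpr
    (by simpa using hp.out)).dvd_or_dvd hdvd).elim ht₁ ht₂⟩
  push_cast at he₁ he₂ ⊢
  linear_combination ((ℓ : ℂ) - (a : ℂ) * ζ⁻¹) * w₂ * he₁ + (t₁ : ℂ) * he₂

end Products

/-! ### §2 One odd character: the twisted symbol sum is `p`-integral against `|Ω⁻(W)|·i` -/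

section OneCharacter

variable {W : WeierstrassCurve ℚ} [W.IsElliptic] [W.IsGloballyMinimal] {N : ℕ} [NeZero N]
  {p : ℕ} [hp : Fact p.Prime]

/-- **One odd character.** GRANTED the fact: for `W` globally minimal, additive at `p > 7`, `E[p]`
irreducible, newform `f` at a level `N` with `p² ∣ N` satisfying (A²), a prime `d′ > N` with `p ∤ d′ − 1`
and `r ∤ d′ − 1` for the odd primes `r ∣ p − 1`, and an ODD character `χ (mod d′)` (primitive, `≠ 1`, of
order `∣ d′ − 1`): `Σ_a χ(a){∞, a/d′}_f / (|Ω⁻(W)| i)` is `p`-integral — the symmetric Euler factors are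
`p`-units by `exists_symmEulerFactor_mul_eq` (`χ(ℓ)^{d′−1} = 1`). [cite: Kato2004Asterisque, Thm. 9.7 (p. 189)]
[cite: KimNakamura2020, Cor. 2.4] -/
theorem pint_twistedSymbolSum_div (hK : kato_neron_isIntegral_twistedSymbolSum_of_additive)
    (hp7 : 7 < p) (hadd : Addv W p) (hirr : Irr W p) (f : CuspForm (Gamma0 N) 2) (hf : IsNewformOf W f)
    (hpN : p ^ 2 ∣ N)
    (hA : ∀ ℓ ∈ N.primeFactors, ¬ ℓ ^ 2 ∣ N →
      ∀ j : ℕ, ((ℓ : ZMod p) / (W.LFunction ℓ : ZMod p)) ^ 2 ^ j ≠ 1)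
    {d' : ℕ} (hd' : d'.Prime) (hNd' : N < d') (hpd' : ¬ p ∣ d' - 1)
    (hrd' : ∀ r : ℕ, r.Prime → r ≠ 2 → r ∣ p - 1 → ¬ r ∣ d' - 1)
    {ϖ : ℚ} (hϖ : (ϖ : ℝ) * W.imaginaryPeriodRat = minusPeriod f)
    (χ : DirichletCharacter ℂ d') (hχ : χ.Odd) :
    haveI : NeZero d' := ⟨hd'.ne_zero⟩
    ∃ s : ℕ, ¬ p ∣ s ∧ IsIntegral ℤ ((s : ℂ) *
      (twistedSymbolSum f χ / ((W.imaginaryPeriodRat : ℂ) * I))) := by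
  haveI : NeZero d' := ⟨hd'.ne_zero⟩
  haveI : Fact d'.Prime := ⟨hd'⟩
  have hpP : p.Prime := hp.out
  have hN0 : N ≠ 0 := NeZero.ne N
  -- `χ ≠ 1`, primitive, of order prime to `p`
  have hχ1 : χ ≠ 1 := by
    intro h
    have h1 : χ (-1) = -1 := hχ
    rw [h, MulChar.one_apply (isUnit_one.neg)] at h1
    norm_num at h1
  have hprim : χ.IsPrimitive := by
    rw [DirichletCharacter.isPrimitive_def]
    rcases (Nat.dvd_prime hd').mp (DirichletCharacter.conductor_dvd_level χ) with h | h
    · exact absurd (DirichletCharacter.eq_one_iff_conductor_eq_one.mpr h) hχ1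
    · exact h
  have hord : ¬ p ∣ orderOf χ := by
    intro h
    have h1 : orderOf χ ∣ Fintype.card (DirichletCharacter ℂ d') := orderOf_dvd_card
    have h2 : Fintype.card (DirichletCharacter ℂ d') = d'.totient := by
      rw [← Nat.card_eq_fintype_card]
      exact DirichletCharacter.card_eq_totient_of_hasEnoughRootsOfUnity ℂ d'
    rw [h2, Nat.totient_prime hd'] at h1
    exact hpd' (h.trans h1)
  have hpd'ne : p ≠ d' := by
    rintro rfl
    exact absurd (Nat.le_of_dvd (Nat.pos_of_ne_zero hN0) ((dvd_pow_self p two_ne_zero).trans hpN))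
      (not_le.mpr hNd')
  have hm : d'.Coprime (p * N) := Nat.Coprime.mul_right ((Nat.coprime_primes hd' hpP).mpr hpd'ne.symm)
    ((hd'.coprime_iff_not_dvd).mpr fun h ↦ absurd (Nat.le_of_dvd (Nat.pos_of_ne_zero hN0) h)
      (not_le.mpr hNd'))
  -- the value `r` and the fact
  have hΩf : 0 < minusPeriod f := IsNewform0.minusPeriod_pos_holds hf.1 hf.coeffField_eq_bot
  have hΩ : 0 < W.imaginaryPeriodRat := W.imaginaryPeriodRat_pos
  have hϖ0 : (ϖ : ℂ) ≠ 0 := by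
    have : (ϖ : ℝ) ≠ 0 := by
      rintro h; rw [h, zero_mul] at hϖ; exact hΩf.ne' hϖ.symm
    exact_mod_cast this
  have hΩfC : ((minusPeriod f : ℝ) : ℂ) = (ϖ : ℂ) * (W.imaginaryPeriodRat : ℂ) := by
    rw [← hϖ]; push_cast; ring
  set E : ℂ := ∏ ℓ ∈ N.primeFactors with ¬ ℓ ^ 2 ∣ N,
      (((ℓ : ℂ) - (W.LFunction ℓ : ℂ) * χ (ℓ : ZMod d')) *
        ((ℓ : ℂ) - (W.LFunction ℓ : ℂ) * (χ (ℓ : ZMod d'))⁻¹)) with hEdef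
  set T : ℂ := twistedSymbolSum f χ with hTdef
  set r : ℂ := E * T / (((minusPeriod f : ℝ) : ℂ) * I) with hrdef
  have hden : ((minusPeriod f : ℝ) : ℂ) * I ≠ 0 :=
    mul_ne_zero (by exact_mod_cast hΩf.ne') I_ne_zero
  have hval : E * T = r * ((minusPeriod f : ℝ) : ℂ) * I := by
    rw [hrdef, mul_assoc, div_mul_cancel₀ _ hden]
  obtain ⟨s, hs, hint⟩ :=
    (hK W f hf p hp7 hadd.1 hadd.2 hirr d' hm χ hprim hχ1 hord ϖ r).2 hχ hϖ hval
  -- `ϖ r = E · (T / (Ω i))`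
  have hre : (ϖ : ℂ) * r = E * (T / ((W.imaginaryPeriodRat : ℂ) * I)) := by
    rw [hrdef, hΩfC]
    have hΩ0 : (W.imaginaryPeriodRat : ℂ) ≠ 0 := by exact_mod_cast hΩ.ne'
    field_simp
  have hpint : ∃ s : ℕ, ¬ p ∣ s ∧ IsIntegral ℤ ((s : ℂ) * (E * (T / ((W.imaginaryPeriodRat : ℂ) * I)))) :=
    ⟨s, hs, by rw [← hre, ← mul_assoc]; exact hint⟩
  -- cancel the `p`-unit `E`
  have hEwt : ∃ (w : ℂ) (t : ℤ), IsIntegral ℤ w ∧ E * w = t ∧ ¬ (p : ℤ) ∣ t := by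
    rw [hEdef]
    refine exists_prod_mul_eq hpP _ _ fun ℓ hℓ ↦ ?_
    obtain ⟨hℓN, hℓ2⟩ := Finset.mem_filter.mp hℓ
    have hℓp : (Nat.prime_of_mem_primeFactors hℓN) = Nat.prime_of_mem_primeFactors hℓN := rfl
    have hℓprime := Nat.prime_of_mem_primeFactors hℓN
    have hℓne : ℓ ≠ p := by
      rintro rfl; exact hℓ2 hpN
    have hℓ0 : ((ℓ : ZMod p)) ≠ 0 := by
      rw [Ne, ZMod.natCast_eq_zero_iff]
      exact fun h ↦ hℓne ((Nat.prime_dvd_prime_iff_eq hpP hℓprime).mp h).symm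
    -- `χ(ℓ)^{d′−1} = 1`
    have hℓd' : ((ℓ : ZMod d')) ≠ 0 := by
      rw [Ne, ZMod.natCast_eq_zero_iff]
      exact fun h ↦ absurd (Nat.le_of_dvd hℓprime.pos h)
        (not_le.mpr ((Nat.le_of_dvd (Nat.pos_of_ne_zero hN0) (Nat.dvd_of_mem_primeFactors hℓN)).trans_lt hNd'))
    have hζ : (χ (ℓ : ZMod d')) ^ (d' - 1) = 1 := by
      rw [← map_pow, ZMod.pow_card_sub_one_eq_one hℓd', map_one]
    exact exists_symmEulerFactor_mul_eq ℓ (W.LFunction ℓ) hℓ0 (hA ℓ hℓN hℓ2)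
      (Nat.sub_pos_of_lt hd'.one_lt) hrd' hζ
  obtain ⟨w, t, hw, hEw, ht⟩ := hEwt
  exact pint_of_pint_mul_of_mul_eq hpP hw hEw ht hpint

end OneCharacter

end Summit.BirchSwinnertonDyer.BirchSwinnertonDyer.Theorems.ManinFrameResidueProperRTameTwist

end
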